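import Mathlib
import HarnessLib

/-!
# Teräväinen 2024, §5.1: from logarithmic to plain averages

Support file (everything PROVED; no definitions, no named facts) towards the named fact
`Literature.NumberTheory.Sieve.teravainen2024_cor_2_1` (J. Teräväinen, *On the Liouville function
at polynomial arguments*, Amer. J. Math. 146 (2024) = arXiv:2010.07924, Corollary 2.1 ⊂
Theorem 2.6 for `g_j = λ`, proved in §5). The first display of §5.1 (p. 9):

> "if for some `η > 0`, `ω ≥ 2` we have `|𝔼^{log}_{x/ω≤n≤x} g_1(a_1n+h_1)⋯g_k(a_kn+h_k)| ≤ 1-η`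
> for all large enough `x`, then by splitting the `n` average into short segments and applying
> Chebychev's inequality, we see that `|𝔼_{n≤x} g_1(a_1n+h_1)⋯g_k(a_kn+h_k)| ≤ 1-η²/ω` for all
> large enough `x`."

We prove this for an arbitrary `1`-bounded sequence `F`, pointwise in `x` (for `η ≤ 1/2`,
`2 ≤ ω ≤ x`), by a direct positivity argument: if `|∑_{n≤x} F(n)| > (1-η²/ω)x` then after a
rotation `∑_{n≤x} (1 - Re F(n)) < η²x/ω`, so `∑_{x/ω≤n≤x} (1 - Re F(n))/n ≤ η²`, while
`∑_{x/ω≤n≤x} 1/n ≥ 1/2`; hence `Re 𝔼^{log} F > 1 - 2η² ≥ 1 - η`.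

* `Teravainen2024.norm_sum_Icc_le_of_logAvg_le` — the statement above.

## References
* J. Teräväinen, Amer. J. Math. 146 (2024), §5.1 (first display, p. 9), arXiv:2010.07924.
  [Teravainen2024]
-/

noncomputable section

open Finset Complex

namespace Literature.NumberTheory.Sieve

namespace Teravainen2024

/-- `∑_{x/ω ≤ n ≤ x} 1/n > 1/2` for `2 ≤ ω ≤ x` (there are `> x/2` terms each `≥ 1/x`).
[folklore] -/
theorem half_lt_sum_Icc_inv {ω x : ℕ} (hω : 2 ≤ ω) (hx : ω ≤ x) :
    (1 : ℝ) / 2 < ∑ n ∈ Finset.Icc (x / ω) x, (1 : ℝ) / n := by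
  have hx0 : 0 < x := by omega
  have hxR : (0 : ℝ) < x := by exact_mod_cast hx0
  have hcard : x / 2 ≤ #(Finset.Icc (x / ω) x) := by
    rw [Nat.card_Icc]
    have : x / ω ≤ x / 2 := Nat.div_le_div_left hω (by norm_num)
    omega
  calc (1 : ℝ) / 2 < ((x / 2 + 1 : ℕ) : ℝ) * (1 / x) := by
        rw [mul_one_div, lt_div_iff₀ hxR]
        have h1 : x < 2 * (x / 2 + 1) := by omega
        have : (x : ℝ) < 2 * ((x / 2 + 1 : ℕ) : ℝ) := by exact_mod_cast h1
        linarith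
    _ ≤ (#(Finset.Icc (x / ω) x) : ℝ) * (1 / x) := by
        apply mul_le_mul_of_nonneg_right _ (by positivity)
        have h1 : x / 2 + 1 ≤ #(Finset.Icc (x / ω) x) := by
          rw [Nat.card_Icc]
          have : x / ω ≤ x / 2 := Nat.div_le_div_left hω (by norm_num)
          omega
        exact_mod_cast h1
    _ = ∑ _n ∈ Finset.Icc (x / ω) x, (1 : ℝ) / x := by rw [Finset.sum_const, nsmul_eq_mul]
    _ ≤ ∑ n ∈ Finset.Icc (x / ω) x, (1 : ℝ) / n := by
        refine Finset.sum_le_sum fun n hn => ?_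
        rw [Finset.mem_Icc] at hn
        rcases Nat.eq_zero_or_pos n with h0 | hpos
        · subst h0
          simp only [CharP.cast_eq_zero, div_zero]
          -- `n = 0` only if `x / ω = 0`; then the term is `0 ≤ …`? we need `1/x ≤ 0`: impossible,
          -- so exclude: `x / ω ≥ 1` as `ω ≤ x`.
          exfalso
          have : 1 ≤ x / ω := (Nat.le_div_iff_mul_le (by omega)).mpr (by simpa using hx)
          omega
        · apply one_div_le_one_div_of_le (by exact_mod_cast hpos)
          exact_mod_cast hn.2

/-- Weights on `[x/ω, x]`: `1/n ≤ 2ω/x` for `n ≥ ⌊x/ω⌋`, `2ω ≤ x`. [folklore] -/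
theorem inv_le_of_mem_Icc_div {ω x n : ℕ} (hω : 1 ≤ ω) (hx : 2 * ω ≤ x) (hn : x / ω ≤ n) :
    (1 : ℝ) / n ≤ 2 * ω / x := by
  have hx0 : (0 : ℝ) < x := by exact_mod_cast (show 0 < x by omega)
  have hω0 : (0 : ℝ) < ω := by exact_mod_cast (show 0 < ω by omega)
  have hq : 2 ≤ x / ω := (Nat.le_div_iff_mul_le (by omega)).mpr (by linarith)
  have hn0 : (0 : ℝ) < n := by exact_mod_cast (show 0 < n by omega)
  rw [div_le_div_iff₀ hn0 hx0, one_mul]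
  -- `x < ω (x/ω + 1) ≤ ω (n + 1) ≤ 2 ω n`
  have h1 : x < ω * (x / ω + 1) := by
    have := Nat.div_add_mod x ω; have := Nat.mod_lt x (show 0 < ω by omega)
    rw [Nat.mul_add, mul_one]; omega
  have h2 : ω * (x / ω + 1) ≤ ω * (n + 1) := Nat.mul_le_mul_left ω (by omega)
  have h3 : ω * (n + 1) ≤ 2 * ω * n := by nlinarith
  have : x ≤ 2 * ω * n := by omega
  exact_mod_cast this

/-- **From logarithmic to plain averages** (Teräväinen 2024, §5.1, first display). Let `F` be
`1`-bounded, `0 < η ≤ 1/4`, `1 ≤ ω`, `2ω ≤ x`. If the logarithmic average over `[x/ω, x]` is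
bounded away from the unit circle, `|∑_{x/ω≤n≤x} F(n)/n| ≤ (1-η) ∑_{x/ω≤n≤x} 1/n`, then so is
the plain average: `|∑_{1≤n≤x} F(n)| ≤ (1 - η²/ω) x`.
[cite: Teravainen2024, §5.1 (first display, p. 9)] -/
theorem norm_sum_Icc_le_of_logAvg_le {F : ℕ → ℂ} (hF : ∀ n, ‖F n‖ ≤ 1) {η : ℝ} (hη0 : 0 < η)
    (hη : η ≤ 1 / 4) {ω x : ℕ} (hω : 2 ≤ ω) (hx : 2 * ω ≤ x)
    (hlog : ‖∑ n ∈ Finset.Icc (x / ω) x, F n / n‖ ≤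
      (1 - η) * ∑ n ∈ Finset.Icc (x / ω) x, (1 : ℝ) / n) :
    ‖∑ n ∈ Finset.Icc 1 x, F n‖ ≤ (1 - η ^ 2 / ω) * x := by
  by_contra hcon
  rw [not_le] at hcon
  have hx0 : 0 < x := by omega
  have hxR : (0 : ℝ) < x := by exact_mod_cast hx0
  have hωR : (2 : ℝ) ≤ ω := by exact_mod_cast hω
  have hω0 : (0 : ℝ) < ω := by linarith
  set S : ℂ := ∑ n ∈ Finset.Icc 1 x, F n with hS
  have hS0 : S ≠ 0 := by
    intro h; rw [h, norm_zero] at hcon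
    have : 0 ≤ (1 - η ^ 2 / ω) * x := by
      apply mul_nonneg _ hxR.le
      rw [sub_nonneg, div_le_one hω0]; nlinarith
    linarith
  -- rotate: `θ = conj S/|S|`, so that `θ S = |S|` and `|θ| = 1`
  have hSn : (0 : ℝ) < ‖S‖ := norm_pos_iff.mpr hS0
  set θ : ℂ := (starRingEnd ℂ) S / (‖S‖ : ℂ) with hθ
  have hθ1 : ‖θ‖ = 1 := by
    rw [hθ, norm_div, Complex.norm_conj, Complex.norm_real, Real.norm_eq_abs, abs_of_pos hSn,
      div_self hSn.ne']
  have hθS : (θ * S).re = ‖S‖ := by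
    have : θ * S = ((‖S‖ ^ 2 : ℝ) : ℂ) / (‖S‖ : ℂ) := by
      rw [hθ, div_mul_eq_mul_div, Complex.conj_mul']
      push_cast; ring
    rw [this, ← Complex.ofReal_div, Complex.ofReal_re, sq, mul_self_div_self]
  -- deficiencies `u n = 1 - Re(θ F n) ≥ 0`
  set u : ℕ → ℝ := fun n => 1 - (θ * F n).re with hu
  have hu0 : ∀ n, 0 ≤ u n := by
    intro n
    have : (θ * F n).re ≤ ‖θ * F n‖ := Complex.re_le_norm _
    have h2 : ‖θ * F n‖ ≤ 1 := by rw [norm_mul, hθ1, one_mul]; exact hF n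
    simp only [hu]; linarith
  -- `∑_{n≤x} u n = x - |S| < η² x/ω`
  have hsum_u : ∑ n ∈ Finset.Icc 1 x, u n = x - ‖S‖ := by
    simp only [hu, Finset.sum_sub_distrib, Finset.sum_const, Nat.card_Icc, Nat.add_sub_cancel,
      nsmul_eq_mul, mul_one]
    rw [← Complex.re_sum, ← Finset.mul_sum, ← hS, hθS]
  have hsmall : ∑ n ∈ Finset.Icc 1 x, u n < η ^ 2 / ω * x := by
    rw [hsum_u]; nlinarith
  -- restrict to `[x/ω, x]` with weights `1/n ≤ 2ω/x`
  have hx1 : 1 ≤ x / ω := (Nat.le_div_iff_mul_le (by omega)).mpr (by simp; omega)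
  have hsub : Finset.Icc (x / ω) x ⊆ Finset.Icc 1 x := Finset.Icc_subset_Icc_left hx1
  have hwt : ∑ n ∈ Finset.Icc (x / ω) x, u n / n ≤ 2 * η ^ 2 := by
    calc ∑ n ∈ Finset.Icc (x / ω) x, u n / n ≤ ∑ n ∈ Finset.Icc (x / ω) x, (2 * ω / x) * u n := by
          refine Finset.sum_le_sum fun n hn => ?_
          rw [Finset.mem_Icc] at hn
          rw [div_eq_mul_one_div, mul_comm]
          exact mul_le_mul_of_nonneg_right (inv_le_of_mem_Icc_div (by omega) hx hn.1) (hu0 n)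
      _ = (2 * ω / x) * ∑ n ∈ Finset.Icc (x / ω) x, u n := by rw [Finset.mul_sum]
      _ ≤ (2 * ω / x) * ∑ n ∈ Finset.Icc 1 x, u n := by
          apply mul_le_mul_of_nonneg_left _ (by positivity)
          exact Finset.sum_le_sum_of_subset_of_nonneg hsub fun n _ _ => hu0 n
      _ ≤ (2 * ω / x) * (η ^ 2 / ω * x) := mul_le_mul_of_nonneg_left hsmall.le (by positivity)
      _ = 2 * η ^ 2 := by field_simp
  -- the logarithmic average of `θ F` has real part `≥ H - 2η²`
  set H : ℝ := ∑ n ∈ Finset.Icc (x / ω) x, (1 : ℝ) / n with hH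
  have hH2 : 1 / 2 < H := half_lt_sum_Icc_inv hω (by omega)
  have hre : (θ * ∑ n ∈ Finset.Icc (x / ω) x, F n / n).re = H - ∑ n ∈ Finset.Icc (x / ω) x, u n / n := by
    rw [Finset.mul_sum, Complex.re_sum, hH, ← Finset.sum_sub_distrib]
    refine Finset.sum_congr rfl fun n _ => ?_
    simp only [hu]
    rw [← mul_div_assoc, Complex.div_natCast_re]
    ring
  have hbig : (1 - η) * H < ‖∑ n ∈ Finset.Icc (x / ω) x, F n / n‖ := by
    calc (1 - η) * H < H - 2 * η ^ 2 := by nlinarith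
      _ ≤ (θ * ∑ n ∈ Finset.Icc (x / ω) x, F n / n).re := by rw [hre]; linarith
      _ ≤ ‖θ * ∑ n ∈ Finset.Icc (x / ω) x, F n / n‖ := Complex.re_le_norm _
      _ = ‖∑ n ∈ Finset.Icc (x / ω) x, F n / n‖ := by rw [norm_mul, hθ1, one_mul]
  linarith

end Teravainen2024

end Literature.NumberTheory.Sieve
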